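import Summits.QuantumFields.YangMills.Theorems.BalabanUVNodesN15CurvedGluingCubeDressedGeneralGauge
import Summits.QuantumFields.YangMills.Theorems.BalabanUVNodesN15AdjointGaugeAction
import HarnessLib

/-!
# Route «BalabanUVNodes» (cluster K4 «SpineRates»), Track-A DAG node N15 = NE2, BACKGROUND LAYER — PER-CUBE GAUGES AT THE GAUGE GROUP OF RECORD: the `U(N)`-valued site gauge
# fields `u_□ : X → U(N)` of (3.35) act by `W(x) = coordMat e (Ad_{u(x)})`, orthogonal on both sides, so the per-cube gauge transfer of `…CurvedGluingCubeDressedGeneralGauge` holds with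
# NO orthogonality hypothesis; and the two-grid FIT of two such gauges is read off the bond-free letter `‖u′(x′) − u(πx′)‖ ≤ o` (`‖Ad_{u′} − Ad_u‖ ≤ (‖u′‖ + ‖u‖)‖u′ − u‖`, `‖u‖_F = √N`)

Cell `pub-ymgap`, seat `pub-ymgap-dag-n15-w2` (WIDTH SEAT 2∕3 on node N15, director-ym №197 ∕ HUMAN RULING D-0149), g4, second piece — the `U(N)` edition of dag-n15-w3 g3's located item (i)
«per-cube GAUGES», in this seat's g2 lineage (`…N15AdjointGaugeAction`: `uN_siteGauge_orthogonal`, `uN_siteGauge_transpose_eq`; `…N15AdjointTransportExp`: `uN_coordMat_conj_orthogonal`).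
`bears_on: R4∕N15 · K3⁷ SpineGivenEndpointR13SepCoPH (stmt-QuantumFields-20544)`.  Filed `--kind proof --supports stmt-QuantumFields-20544 --as helper` — COUNT-NEUTRAL.  Theorems only,
0 `def`, 0 `sorry`.  Imports BY NAME this seat's `…CurvedGluingCubeDressedGeneralGauge` (`hloc_defect_of_localGauge`, `inverse_of_localGauge`, `hasMaj_gaugeConj(_back∕_loc₂)`,
`hasMaj_idef_gaugeConj(_of_pullback)`) and `…N15AdjointGaugeAction` (`uN_siteGauge_orthogonal`, `uN_siteGauge_transpose_eq`; through it n15-b part 16 `coordMat`, `basisConst`,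
`rowFit_of_opNormFit`, lit `traceForm`, Mathlib's Frobenius norm scope); nothing in the tree is modified, no landed name re-declared.

WHY.  (3.35) p. 396 of [Balaban1985BackgroundPropagators] produces, cube by cube, a LATTICE gauge transformation `u_□ : □̃ → G = U(N)` (resp. `SU(N)`); on `𝔤`-valued fields it acts by
the adjoint action `Ad_{u(x)} : X ↦ u(x)Xu(x)ᴴ`, i.e. by the site matrix field `W(x) = coordMat e (Ad_{u(x)})` in trace-form-orthonormal coordinates `e` of `𝔤 ≅ ℝ^κ`.  File
`…DressedGeneralGauge` transfers every per-cube row from the local to the global gauge for an ABSTRACT site-wise orthogonal `W` (`WWᵀ = WᵀW = 1`), and its two-grid theorem displays the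
max-row-sum fit `Σ_j|W′(x′) − W(πx′)|_{ij} ≤ o` of the fine and coarse gauges.  THIS FILE inhabits both at the objects of record:
* §1 for `U(N)`-valued `u` (`u(x)ᴴu(x) = 1`) the two orthogonality hypotheses are THEOREMS (g2 `uN_siteGauge_orthogonal`), so ★★ `uN_hloc_defect_of_localGauge`, ★ `uN_inverse_of_localGauge`,
  ★★ `uN_hasMaj_gaugeConj` ∕ `_back` ∕ `_loc₂` and ★★ `uN_hasMaj_idef_gaugeConj_of_pullback` (fine gauge `u∘π` = the pulled-back coarse gauge) hold with NO gauge hypothesis left;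
* §2 the FIT from the gauge fields themselves: `‖Ad_{u′} − Ad_u‖ ≤ ‖u′ − u‖·‖u′ᴴ‖ + ‖u‖·‖u′ᴴ − uᴴ‖` in any normed algebra (`norm_mulLeftRight_sub_mulLeftRight_le`), hence in the Frobenius norm
  `≤ (‖u′‖ + ‖u‖)·‖u′ − u‖` (`uN_opNorm_conj_sub_conj_le`); ★ `uN_frobenius_norm_of_unitary`: `‖u‖_F = √|n|` for `uᴴu = 1`; so ★★ `uN_rowFit_siteGauge` ∕ `uN_rowFit_siteGauge_transpose`:
  `‖u′(x′) − u(πx′)‖ ≤ o ⟹ Σ_j|W′(x′)_{ij} − W(πx′)_{ij}| ≤ κ_e·(2√|n|·o)` and the same for the transposed fields (`Wᵀ = coordMat e (Ad_{uᴴ})`, g2 `uN_siteGauge_transpose_eq`);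
* §3 ★★★ `uN_hasMaj_idef_gaugeConj_exp`: the (3.42)-type η-defect row of a cube operator under two `U(N)` per-cube gauges `u′` (fine), `u` (coarse) agreeing up to `o` across the grids:
  `𝔇(T′^{W′}, T^W) ≤ (|κ|²m_𝔇 + 2|κ|·κ_e·2√|n|·o·β)·e^{−δd}` — every letter read off `u, u′`, no displayed gauge hypothesis.

HONEST FRAMING ∕ LIMITS.  Finite-dimensional linear algebra over DISPLAYED cube rows (`T ≤ βe^{−δd}` at both grids, `𝔇(T′,T) ≤ m_𝔇e^{−δd}`) and the displayed gauge-field fit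
`‖u′(x′) − u(πx′)‖_F ≤ o`; (3.35) p. 396, (3.42) p. 397, (3.50) p. 400 = SHAPES ∕ MECHANISM — nothing of [B5]∕[B6]∕[B9] asserted; the file does NOT produce the local gauges `u_□` of (3.35)
nor their fit across grids (that is [B9]'s small-field geometry + [Balaban1985Averaging]-type axial gauges, lane-held).  NE2⁺ NOT PRINTED, NOT proved; N15 NOT discharged; K3⁷ OPEN, not
claimed, skeleton v5 untouched; counts of record UNMOVED (typed 28∕28 · discharged 5∕27 · A 5∕28); no summit statement is proved here; one finite 𝕋⁴ at fixed ε — NOT ℝ⁴ ∕ OS ∕ mass gap ∕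
Clay; R4 closes the conditional finite-𝕋⁴ rung `BalabanLadder.UV` only.  Restate-immune (no Theses import).
-/

set_option autoImplicit false

noncomputable section
open scoped BigOperators Matrix Matrix.Norms.Frobenius

namespace Summit.QuantumFields.YangMills.BalabanUVNodes.N15.CurvedSpecies

open Literature.MathematicalPhysics.QuantumFieldTheory.Balaban1983to89
open Literature.MathematicalPhysics.QuantumFieldTheory.Balaban1983to89.B11SectG (BlockNorm HasMaj)
open Literature.MathematicalPhysics.QuantumFieldTheory.Balaban1983to89.B6Prop26Gluing (mulOp ind)
open Literature.MathematicalPhysics.QuantumFieldTheory.Balaban1983to89.T4EtaRateDefect (idef)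
open Literature.MathematicalPhysics.QuantumFieldTheory.Balaban1983to89.T4EtaRateCoeffDefect (pull)
open Summit.QuantumFields.YangMills.BalabanUVNodes.N15.MatrixSpecies (mmulOp liftMap liftBlk coordMat basisConst basisConst_nonneg rowFit_of_opNormFit)
open Summit.QuantumFields.YangMills.BalabanUVNodes.N15.BackgroundLayer (covLapM)
open Literature.Barriers.QuantumFields (traceForm)

/-! ## §1 `U(N)` site gauges: the per-cube gauge transfer with the orthogonality hypotheses DISCHARGED -/

section SiteGauge

variable {n : Type} [Fintype n] [DecidableEq n] {κ : Type} [Fintype κ] [DecidableEq κ] (e : Matrix n n ℂ ≃L[ℝ] (κ → ℝ)) {X J : Type} [Fintype J] (η : ℝ) (τ : J → X ≃ X)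
  (u : X → Matrix n n ℂ)

/-- ★★ **`hloc` MODULO A DEFECT FROM THE LOCAL `U(N)` GAUGE OF A CUBE** (`hloc_defect_of_localGauge` with `hW`, `hW'` discharged by g2 `uN_siteGauge_orthogonal`): for a `U(N)`-valued site
field `u` and `W(x) = coordMat e (Ad_{u(x)})`, a cube parametrix `G′` of `Δ_{gaugePair R^W} + P′` behind `χ` with defect `E′` gives, conjugated back, a cube parametrix `M_{Wᵀ}G′M_W` of
`Δ_{gaugePair R} + M_{Wᵀ}P′M_W` with defect `M_{Wᵀ}E′M_W`. [cite: Balaban1985BackgroundPropagators, (3.34)–(3.35) p.396, (3.50) p.400, (3.65) p.403 (shapes ∕ mechanism)] -/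
theorem uN_hloc_defect_of_localGauge (he : ∀ A B : Matrix n n ℂ, traceForm A B = e A ⬝ᵥ e B) (hu : ∀ x, (u x)ᴴ * u x = 1) (R : J → X → Matrix κ κ ℝ) {χX : X → ℝ}
    {P' G' E' : (X × κ → ℝ) →ₗ[ℝ] (X × κ → ℝ)}
    (hloc' : mulOp (fun p : X × κ => χX p.1) ∘ₗ
        (covLapM τ η (gaugePair τ (trGaugeActFwd τ (fun x => coordMat e (ContinuousLinearMap.mulLeftRight ℝ (Matrix n n ℂ) (u x) (u x)ᴴ)) R)) + P') ∘ₗ G' =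
      mulOp (fun p : X × κ => χX p.1) + E') :
    mulOp (fun p : X × κ => χX p.1) ∘ₗ
        (covLapM τ η (gaugePair τ R) + mmulOp (fun x => (coordMat e (ContinuousLinearMap.mulLeftRight ℝ (Matrix n n ℂ) (u x) (u x)ᴴ))ᵀ) ∘ₗ P' ∘ₗ
          mmulOp (fun x => coordMat e (ContinuousLinearMap.mulLeftRight ℝ (Matrix n n ℂ) (u x) (u x)ᴴ))) ∘ₗ
      (mmulOp (fun x => (coordMat e (ContinuousLinearMap.mulLeftRight ℝ (Matrix n n ℂ) (u x) (u x)ᴴ))ᵀ) ∘ₗ G' ∘ₗ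
        mmulOp (fun x => coordMat e (ContinuousLinearMap.mulLeftRight ℝ (Matrix n n ℂ) (u x) (u x)ᴴ))) =
      mulOp (fun p : X × κ => χX p.1) +
        mmulOp (fun x => (coordMat e (ContinuousLinearMap.mulLeftRight ℝ (Matrix n n ℂ) (u x) (u x)ᴴ))ᵀ) ∘ₗ E' ∘ₗ
          mmulOp (fun x => coordMat e (ContinuousLinearMap.mulLeftRight ℝ (Matrix n n ℂ) (u x) (u x)ᴴ)) :=
  hloc_defect_of_localGauge (fun x => coordMat e (ContinuousLinearMap.mulLeftRight ℝ (Matrix n n ℂ) (u x) (u x)ᴴ)) τ η (fun x => (uN_siteGauge_orthogonal e u he hu x).1) (fun x => (uN_siteGauge_orthogonal e u he hu x).2) R hloc'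

/-- ★ **INVERSES FROM THE LOCAL `U(N)` GAUGE** (`inverse_of_localGauge`, orthogonality discharged). [cite: Balaban1985BackgroundPropagators, (3.35) p.396, (3.50) p.400 (shapes)] -/
theorem uN_inverse_of_localGauge (he : ∀ A B : Matrix n n ℂ, traceForm A B = e A ⬝ᵥ e B) (hu : ∀ x, (u x)ᴴ * u x = 1) (R : J → X → Matrix κ κ ℝ)
    {P' G' : (X × κ → ℝ) →ₗ[ℝ] (X × κ → ℝ)}
    (hG' : (covLapM τ η (gaugePair τ (trGaugeActFwd τ (fun x => coordMat e (ContinuousLinearMap.mulLeftRight ℝ (Matrix n n ℂ) (u x) (u x)ᴴ)) R)) + P') ∘ₗ G' = LinearMap.id) :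
    (covLapM τ η (gaugePair τ R) + mmulOp (fun x => (coordMat e (ContinuousLinearMap.mulLeftRight ℝ (Matrix n n ℂ) (u x) (u x)ᴴ))ᵀ) ∘ₗ P' ∘ₗ
          mmulOp (fun x => coordMat e (ContinuousLinearMap.mulLeftRight ℝ (Matrix n n ℂ) (u x) (u x)ᴴ))) ∘ₗ
      (mmulOp (fun x => (coordMat e (ContinuousLinearMap.mulLeftRight ℝ (Matrix n n ℂ) (u x) (u x)ᴴ))ᵀ) ∘ₗ G' ∘ₗ
        mmulOp (fun x => coordMat e (ContinuousLinearMap.mulLeftRight ℝ (Matrix n n ℂ) (u x) (u x)ᴴ))) = LinearMap.id :=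
  inverse_of_localGauge (fun x => coordMat e (ContinuousLinearMap.mulLeftRight ℝ (Matrix n n ℂ) (u x) (u x)ᴴ)) τ η (fun x => (uN_siteGauge_orthogonal e u he hu x).1) (fun x => (uN_siteGauge_orthogonal e u he hu x).2) R hG'

variable [Fintype X] {g : B6.Geometry} (blk : X → g.Site)

/-- ★★ **EVERY ROW SURVIVES A `U(N)` GAUGE CHANGE WITH THE FACTOR `|κ|²`** (`hasMaj_gaugeConj`, orthogonality discharged; any non-negative kernel).
[cite: Balaban1985BackgroundPropagators, (3.35) p.396, (3.42) p.397 (shapes)] -/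
theorem uN_hasMaj_gaugeConj (he : ∀ A B : Matrix n n ℂ, traceForm A B = e A ⬝ᵥ e B) (hu : ∀ x, (u x)ᴴ * u x = 1) {T : (X × κ → ℝ) →ₗ[ℝ] (X × κ → ℝ)}
    {K : g.Site → g.Site → ℝ} (hK : ∀ y y', 0 ≤ K y y') (hT : HasMaj (BlockNorm.ofBlocks g (liftBlk blk κ)) (BlockNorm.ofBlocks g (liftBlk blk κ)) T K) :
    HasMaj (BlockNorm.ofBlocks g (liftBlk blk κ)) (BlockNorm.ofBlocks g (liftBlk blk κ))
      (mmulOp (fun x => coordMat e (ContinuousLinearMap.mulLeftRight ℝ (Matrix n n ℂ) (u x) (u x)ᴴ)) ∘ₗ T ∘ₗ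
        mmulOp (fun x => (coordMat e (ContinuousLinearMap.mulLeftRight ℝ (Matrix n n ℂ) (u x) (u x)ᴴ))ᵀ))
      (fun y y' => (Fintype.card κ : ℝ) ^ 2 * K y y') :=
  hasMaj_gaugeConj blk (fun x => coordMat e (ContinuousLinearMap.mulLeftRight ℝ (Matrix n n ℂ) (u x) (u x)ᴴ)) (fun x => (uN_siteGauge_orthogonal e u he hu x).1) (fun x => (uN_siteGauge_orthogonal e u he hu x).2) hK hT

/-- ★★ **… AND THE INVERSE `U(N)` GAUGE CHANGE** (local → global, `hasMaj_gaugeConj_back`). [cite: Balaban1985BackgroundPropagators, (3.35) p.396, (3.42) p.397 (shapes)] -/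
theorem uN_hasMaj_gaugeConj_back (he : ∀ A B : Matrix n n ℂ, traceForm A B = e A ⬝ᵥ e B) (hu : ∀ x, (u x)ᴴ * u x = 1) {T : (X × κ → ℝ) →ₗ[ℝ] (X × κ → ℝ)}
    {K : g.Site → g.Site → ℝ} (hK : ∀ y y', 0 ≤ K y y') (hT : HasMaj (BlockNorm.ofBlocks g (liftBlk blk κ)) (BlockNorm.ofBlocks g (liftBlk blk κ)) T K) :
    HasMaj (BlockNorm.ofBlocks g (liftBlk blk κ)) (BlockNorm.ofBlocks g (liftBlk blk κ))
      (mmulOp (fun x => (coordMat e (ContinuousLinearMap.mulLeftRight ℝ (Matrix n n ℂ) (u x) (u x)ᴴ))ᵀ) ∘ₗ T ∘ₗ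
        mmulOp (fun x => coordMat e (ContinuousLinearMap.mulLeftRight ℝ (Matrix n n ℂ) (u x) (u x)ᴴ)))
      (fun y y' => (Fintype.card κ : ℝ) ^ 2 * K y y') :=
  hasMaj_gaugeConj_back blk (fun x => coordMat e (ContinuousLinearMap.mulLeftRight ℝ (Matrix n n ℂ) (u x) (u x)ᴴ)) (fun x => (uN_siteGauge_orthogonal e u he hu x).1) (fun x => (uN_siteGauge_orthogonal e u he hu x).2) hK hT

/-- ★ THE TWO-SIDED LOCALIZED ROW SHAPE under a `U(N)` gauge change: `X ≤ 1_S1_S·βe^{−ρd} ⟹ X^W ≤ 1_S1_S·(|κ|²β)e^{−ρd}`.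
[cite: Balaban1984PropagatorsII, (2.133) p.247 (shape); Balaban1985BackgroundPropagators, (3.35) p.396, (3.42) p.397] -/
theorem uN_hasMaj_gaugeConj_loc₂ (he : ∀ A B : Matrix n n ℂ, traceForm A B = e A ⬝ᵥ e B) (hu : ∀ x, (u x)ᴴ * u x = 1) {T : (X × κ → ℝ) →ₗ[ℝ] (X × κ → ℝ)} {S : Set g.Site}
    {β ρ : ℝ} (hβ : 0 ≤ β)
    (hT : HasMaj (BlockNorm.ofBlocks g (liftBlk blk κ)) (BlockNorm.ofBlocks g (liftBlk blk κ)) T (fun y y' => ind S y * ind S y' * (β * Real.exp (-(ρ * g.dist y y'))))) :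
    HasMaj (BlockNorm.ofBlocks g (liftBlk blk κ)) (BlockNorm.ofBlocks g (liftBlk blk κ))
      (mmulOp (fun x => coordMat e (ContinuousLinearMap.mulLeftRight ℝ (Matrix n n ℂ) (u x) (u x)ᴴ)) ∘ₗ T ∘ₗ
        mmulOp (fun x => (coordMat e (ContinuousLinearMap.mulLeftRight ℝ (Matrix n n ℂ) (u x) (u x)ᴴ))ᵀ))
      (fun y y' => ind S y * ind S y' * ((Fintype.card κ : ℝ) ^ 2 * β * Real.exp (-(ρ * g.dist y y')))) :=
  hasMaj_gaugeConj_loc₂ blk (fun x => coordMat e (ContinuousLinearMap.mulLeftRight ℝ (Matrix n n ℂ) (u x) (u x)ᴴ)) (fun x => (uN_siteGauge_orthogonal e u he hu x).1) (fun x => (uN_siteGauge_orthogonal e u he hu x).2) hβ hT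

variable {X' : Type} [Fintype X'] (π : X' → X)

/-- ★★ **THE η-DEFECT ROW UNDER THE PULLED-BACK `U(N)` GAUGE** (`u∘π` on the fine grid): `𝔇(T′, T) ≤ K_𝔇 ⟹ 𝔇(T′^{W∘π}, T^W) ≤ |κ|²·K_𝔇`, no gauge hypothesis left.
[cite: Balaban1985BackgroundPropagators, (3.42) p.397, (3.35) p.396 (shapes)] -/
theorem uN_hasMaj_idef_gaugeConj_of_pullback (he : ∀ A B : Matrix n n ℂ, traceForm A B = e A ⬝ᵥ e B) (hu : ∀ x, (u x)ᴴ * u x = 1) {T' : (X' × κ → ℝ) →ₗ[ℝ] (X' × κ → ℝ)}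
    {T : (X × κ → ℝ) →ₗ[ℝ] (X × κ → ℝ)} {KD : g.Site → g.Site → ℝ} (hKD : ∀ y y', 0 ≤ KD y y')
    (hDT : HasMaj (BlockNorm.ofBlocks g (liftBlk blk κ)) (BlockNorm.ofBlocks g (liftBlk (blk ∘ π) κ)) (idef (pull (liftMap π κ)) (pull (liftMap π κ)) T' T) KD) :
    HasMaj (BlockNorm.ofBlocks g (liftBlk blk κ)) (BlockNorm.ofBlocks g (liftBlk (blk ∘ π) κ))
      (idef (pull (liftMap π κ)) (pull (liftMap π κ))
        (mmulOp (fun x' => coordMat e (ContinuousLinearMap.mulLeftRight ℝ (Matrix n n ℂ) (u (π x')) (u (π x'))ᴴ)) ∘ₗ T' ∘ₗ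
          mmulOp (fun x' => (coordMat e (ContinuousLinearMap.mulLeftRight ℝ (Matrix n n ℂ) (u (π x')) (u (π x'))ᴴ))ᵀ))
        (mmulOp (fun x => coordMat e (ContinuousLinearMap.mulLeftRight ℝ (Matrix n n ℂ) (u x) (u x)ᴴ)) ∘ₗ T ∘ₗ
          mmulOp (fun x => (coordMat e (ContinuousLinearMap.mulLeftRight ℝ (Matrix n n ℂ) (u x) (u x)ᴴ))ᵀ)))
      (fun y y' => (Fintype.card κ : ℝ) ^ 2 * KD y y') :=
  hasMaj_idef_gaugeConj_of_pullback π (fun x => coordMat e (ContinuousLinearMap.mulLeftRight ℝ (Matrix n n ℂ) (u x) (u x)ᴴ)) blk hKD (entry_le_one_of_orthogonal fun x => (uN_siteGauge_orthogonal e u he hu x).1)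
    (transpose_entry_le_one_of_orthogonal fun x => (uN_siteGauge_orthogonal e u he hu x).2) hDT

end SiteGauge

/-! ## §2 The two-grid FIT read off the gauge fields: `‖Ad_{u′} − Ad_u‖ ≤ (‖u′‖ + ‖u‖)‖u′ − u‖`, `‖u‖_F = √|n|`, max-row-sum fits of `W`, `Wᵀ` -/

section Fit

variable {𝔄 : Type} [NormedRing 𝔄] [NormedAlgebra ℝ 𝔄]

/-- **LIPSCHITZ LETTER OF THE TWO-SIDED MULTIPLICATION**: `‖(z ↦ uzu′) − (z ↦ vzv′)‖ ≤ ‖u − v‖·‖u′‖ + ‖v‖·‖u′ − v′‖` (`uzu′ − vzv′ = (u − v)zu′ + vz(u′ − v′)`). [folklore] -/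
theorem norm_mulLeftRight_sub_mulLeftRight_le (u u' v v' : 𝔄) :
    ‖ContinuousLinearMap.mulLeftRight ℝ 𝔄 u u' - ContinuousLinearMap.mulLeftRight ℝ 𝔄 v v'‖ ≤ ‖u - v‖ * ‖u'‖ + ‖v‖ * ‖u' - v'‖ := by
  refine ContinuousLinearMap.opNorm_le_bound _ (by positivity) fun z => ?_
  rw [show (ContinuousLinearMap.mulLeftRight ℝ 𝔄 u u' - ContinuousLinearMap.mulLeftRight ℝ 𝔄 v v') z = u * z * u' - v * z * v' from rfl]
  have hsplit : u * z * u' - v * z * v' = (u - v) * z * u' + v * z * (u' - v') := by noncomm_ring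
  rw [hsplit]
  calc ‖(u - v) * z * u' + v * z * (u' - v')‖ ≤ ‖(u - v) * z * u'‖ + ‖v * z * (u' - v')‖ := norm_add_le _ _
    _ ≤ ‖u - v‖ * ‖z‖ * ‖u'‖ + ‖v‖ * ‖z‖ * ‖u' - v'‖ :=
        add_le_add ((norm_mul_le _ _).trans (mul_le_mul_of_nonneg_right (norm_mul_le _ _) (norm_nonneg _)))
          ((norm_mul_le _ _).trans (mul_le_mul_of_nonneg_right (norm_mul_le _ _) (norm_nonneg _)))
    _ = (‖u - v‖ * ‖u'‖ + ‖v‖ * ‖u' - v'‖) * ‖z‖ := by ring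

variable {n : Type} [Fintype n] [DecidableEq n]

/-- ★ **THE ADJOINT ACTIONS OF TWO UNITARY-TYPE ELEMENTS DIFFER BY AT MOST `(‖u′‖ + ‖u‖)·‖u′ − u‖`** in the Frobenius norm (`‖Aᴴ‖ = ‖A‖`, `(u′ − u)ᴴ = u′ᴴ − uᴴ`).
[cite: Balaban1985BackgroundPropagators, (3.35) p.396 (shape: two local gauges compared)] -/
theorem uN_opNorm_conj_sub_conj_le (u' u : Matrix n n ℂ) :
    ‖ContinuousLinearMap.mulLeftRight ℝ (Matrix n n ℂ) u' u'ᴴ - ContinuousLinearMap.mulLeftRight ℝ (Matrix n n ℂ) u uᴴ‖ ≤ (‖u'‖ + ‖u‖) * ‖u' - u‖ := by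
  have h := norm_mulLeftRight_sub_mulLeftRight_le u' u'ᴴ u uᴴ
  rw [Matrix.frobenius_norm_conjTranspose, ← Matrix.conjTranspose_sub, Matrix.frobenius_norm_conjTranspose] at h
  calc _ ≤ ‖u' - u‖ * ‖u'‖ + ‖u‖ * ‖u' - u‖ := h
    _ = (‖u'‖ + ‖u‖) * ‖u' - u‖ := by ring

/-- ★ **THE FROBENIUS NORM OF A UNITARY MATRIX IS `√|n|`**: `uᴴu = 1 ⟹ ‖u‖ = √(card n)` (`Σ_i |u_{ij}|² = (uᴴu)_{jj} = 1` for every column `j`). [folklore] -/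
theorem uN_frobenius_norm_of_unitary {u : Matrix n n ℂ} (hu : uᴴ * u = 1) : ‖u‖ = Real.sqrt (Fintype.card n) := by
  have hcol : ∀ j, ∑ i, ‖u i j‖ ^ (2 : ℝ) = 1 := fun j => by
    have h := congrFun (congrFun hu j) j
    rw [Matrix.mul_apply, Matrix.one_apply_eq] at h
    have h1 : ∑ i, ((‖u i j‖ : ℂ)) ^ 2 = 1 := by
      rw [← h]
      refine Finset.sum_congr rfl fun i _ => ?_
      rw [Matrix.conjTranspose_apply, Complex.star_def, Complex.conj_mul']
    have h2 : ((∑ i, ‖u i j‖ ^ 2 : ℝ) : ℂ) = 1 := by push_cast; exact h1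
    have h3 : ∑ i, ‖u i j‖ ^ 2 = (1 : ℝ) := by exact_mod_cast h2
    simpa only [Real.rpow_two] using h3
  rw [Matrix.frobenius_norm_def, Real.sqrt_eq_rpow]
  congr 1
  rw [Finset.sum_comm]
  simp only [hcol, Finset.sum_const, Finset.card_univ, nsmul_eq_mul, mul_one]

variable {κ : Type} [Fintype κ] [DecidableEq κ] (e : Matrix n n ℂ ≃L[ℝ] (κ → ℝ)) {X X' : Type} (π : X' → X) (u : X → Matrix n n ℂ) (u' : X' → Matrix n n ℂ)

/-- ★★ **THE MAX-ROW-SUM FIT OF TWO `U(N)` SITE GAUGES ACROSS THE GRIDS**: `‖u′(x′) − u(πx′)‖ ≤ o`, `‖u′(x′)‖, ‖u(x)‖ ≤ c` ⟹ `Σ_j|W′(x′)_{ij} − W(πx′)_{ij}| ≤ κ_e·(2c·o)` for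
`W = coordMat e (Ad_u)`, `W′ = coordMat e (Ad_{u′})` (n15-b `rowFit_of_opNormFit` ∘ `uN_opNorm_conj_sub_conj_le`). [cite: Balaban1985BackgroundPropagators, (3.35) p.396, (3.42) p.397 (shapes)] -/
theorem uN_rowFit_siteGauge {o c : ℝ} (hfit : ∀ x', ‖u' x' - u (π x')‖ ≤ o) (hc : ∀ x, ‖u x‖ ≤ c) (hc' : ∀ x', ‖u' x'‖ ≤ c) (x' : X') (i : κ) :
    ∑ j, |coordMat e (ContinuousLinearMap.mulLeftRight ℝ (Matrix n n ℂ) (u' x') (u' x')ᴴ) i j -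
        coordMat e (ContinuousLinearMap.mulLeftRight ℝ (Matrix n n ℂ) (u (π x')) (u (π x'))ᴴ) i j| ≤ basisConst e * (2 * c * o) := by
  refine rowFit_of_opNormFit e π (C' := fun x' => ContinuousLinearMap.mulLeftRight ℝ (Matrix n n ℂ) (u' x') (u' x')ᴴ)
    (C := fun x => ContinuousLinearMap.mulLeftRight ℝ (Matrix n n ℂ) (u x) (u x)ᴴ) (o := fun _ => 2 * c * o) (fun x' => ?_) x' i
  calc _ ≤ (‖u' x'‖ + ‖u (π x')‖) * ‖u' x' - u (π x')‖ := uN_opNorm_conj_sub_conj_le (u' x') (u (π x'))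
    _ ≤ (c + c) * o := mul_le_mul (add_le_add (hc' x') (hc (π x'))) (hfit x') (norm_nonneg _) (by linarith [(norm_nonneg _).trans (hc (π x'))])
    _ = 2 * c * o := by ring

/-- ★★ **… AND OF THEIR TRANSPOSES** (`W(x)ᵀ = coordMat e (Ad_{u(x)ᴴ})`, g2 `uN_siteGauge_transpose_eq`; `‖u′ᴴ − uᴴ‖ = ‖u′ − u‖`, `‖uᴴ‖ = ‖u‖`).
[cite: Balaban1985BackgroundPropagators, (3.35) p.396, (3.42) p.397 (shapes)] -/
theorem uN_rowFit_siteGauge_transpose (he : ∀ A B : Matrix n n ℂ, traceForm A B = e A ⬝ᵥ e B) (hu : ∀ x, (u x)ᴴ * u x = 1) (hu' : ∀ x', (u' x')ᴴ * u' x' = 1)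
    {o c : ℝ} (hfit : ∀ x', ‖u' x' - u (π x')‖ ≤ o) (hc : ∀ x, ‖u x‖ ≤ c) (hc' : ∀ x', ‖u' x'‖ ≤ c) (x' : X') (i : κ) :
    ∑ j, |(coordMat e (ContinuousLinearMap.mulLeftRight ℝ (Matrix n n ℂ) (u' x') (u' x')ᴴ))ᵀ i j -
        (coordMat e (ContinuousLinearMap.mulLeftRight ℝ (Matrix n n ℂ) (u (π x')) (u (π x'))ᴴ))ᵀ i j| ≤ basisConst e * (2 * c * o) := by
  have hT : ∀ x', (coordMat e (ContinuousLinearMap.mulLeftRight ℝ (Matrix n n ℂ) (u' x') (u' x')ᴴ))ᵀ =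
      coordMat e (ContinuousLinearMap.mulLeftRight ℝ (Matrix n n ℂ) (u' x')ᴴ (u' x')ᴴᴴ) := fun x' => by
    rw [uN_siteGauge_transpose_eq e u' he hu' x', Matrix.conjTranspose_conjTranspose]
  have hTu : ∀ x, (coordMat e (ContinuousLinearMap.mulLeftRight ℝ (Matrix n n ℂ) (u x) (u x)ᴴ))ᵀ =
      coordMat e (ContinuousLinearMap.mulLeftRight ℝ (Matrix n n ℂ) (u x)ᴴ (u x)ᴴᴴ) := fun x => by
    rw [uN_siteGauge_transpose_eq e u he hu x, Matrix.conjTranspose_conjTranspose]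
  simp only [hT, hTu]
  refine uN_rowFit_siteGauge e π (fun x => (u x)ᴴ) (fun x' => (u' x')ᴴ) (fun x' => ?_) (fun x => ?_) (fun x' => ?_) x' i
  · rw [← Matrix.conjTranspose_sub, Matrix.frobenius_norm_conjTranspose]; exact hfit x'
  · rw [Matrix.frobenius_norm_conjTranspose]; exact hc x
  · rw [Matrix.frobenius_norm_conjTranspose]; exact hc' x'

end Fit

/-! ## §3 The η-defect row of a cube operator under two `U(N)` per-cube gauges agreeing up to `o` across the grids -/

section TwoGauges

variable {n : Type} [Fintype n] [DecidableEq n] {κ : Type} [Fintype κ] [DecidableEq κ] (e : Matrix n n ℂ ≃L[ℝ] (κ → ℝ)) {X X' : Type} [Fintype X] [Fintype X']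
  (π : X' → X) (u : X → Matrix n n ℂ) (u' : X' → Matrix n n ℂ) {g : B6.Geometry} (blk : X → g.Site)

/-- ★★★ **THE (3.42)-TYPE η-DEFECT ROW UNDER TWO `U(N)` PER-CUBE GAUGES**: rows `T ≤ βe^{−δd}`, `T′ ≤ βe^{−δd}`, defect `𝔇(T′, T) ≤ m_𝔇e^{−δd}`, `U(N)`-valued gauge fields `u`
(coarse), `u′` (fine) with `‖u′(x′) − u(πx′)‖_F ≤ o` ⟹ `𝔇(T′^{W′}, T^W) ≤ (|κ|²m_𝔇 + 2|κ|·(κ_e·2√|n|·o)·β)·e^{−δd}` for `W = coordMat e (Ad_u)`, `W′ = coordMat e (Ad_{u′})` — EVERY gauge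
letter read off `u, u′` (orthogonality, entries `≤ 1`, fits of `W` and `Wᵀ`, `‖u‖_F = √|n|`). [cite: Balaban1985BackgroundPropagators, (3.42) p.397, (3.35) p.396 (shapes); King1986, p.664] -/
theorem uN_hasMaj_idef_gaugeConj_exp (he : ∀ A B : Matrix n n ℂ, traceForm A B = e A ⬝ᵥ e B) (hu : ∀ x, (u x)ᴴ * u x = 1) (hu' : ∀ x', (u' x')ᴴ * u' x' = 1)
    {T' : (X' × κ → ℝ) →ₗ[ℝ] (X' × κ → ℝ)} {T : (X × κ → ℝ) →ₗ[ℝ] (X × κ → ℝ)} {β mD o δ : ℝ} (hβ : 0 ≤ β) (hmD : 0 ≤ mD) (ho : 0 ≤ o)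
    (hfit : ∀ x', ‖u' x' - u (π x')‖ ≤ o)
    (hT : HasMaj (BlockNorm.ofBlocks g (liftBlk blk κ)) (BlockNorm.ofBlocks g (liftBlk blk κ)) T (fun y y' => β * Real.exp (-(δ * g.dist y y'))))
    (hT' : HasMaj (BlockNorm.ofBlocks g (liftBlk (blk ∘ π) κ)) (BlockNorm.ofBlocks g (liftBlk (blk ∘ π) κ)) T' (fun y y' => β * Real.exp (-(δ * g.dist y y'))))
    (hDT : HasMaj (BlockNorm.ofBlocks g (liftBlk blk κ)) (BlockNorm.ofBlocks g (liftBlk (blk ∘ π) κ)) (idef (pull (liftMap π κ)) (pull (liftMap π κ)) T' T)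
      (fun y y' => mD * Real.exp (-(δ * g.dist y y')))) :
    HasMaj (BlockNorm.ofBlocks g (liftBlk blk κ)) (BlockNorm.ofBlocks g (liftBlk (blk ∘ π) κ))
      (idef (pull (liftMap π κ)) (pull (liftMap π κ))
        (mmulOp (fun x' => coordMat e (ContinuousLinearMap.mulLeftRight ℝ (Matrix n n ℂ) (u' x') (u' x')ᴴ)) ∘ₗ T' ∘ₗ
          mmulOp (fun x' => (coordMat e (ContinuousLinearMap.mulLeftRight ℝ (Matrix n n ℂ) (u' x') (u' x')ᴴ))ᵀ))
        (mmulOp (fun x => coordMat e (ContinuousLinearMap.mulLeftRight ℝ (Matrix n n ℂ) (u x) (u x)ᴴ)) ∘ₗ T ∘ₗ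
          mmulOp (fun x => (coordMat e (ContinuousLinearMap.mulLeftRight ℝ (Matrix n n ℂ) (u x) (u x)ᴴ))ᵀ)))
      (fun y y' => ((Fintype.card κ : ℝ) ^ 2 * mD + 2 * (Fintype.card κ : ℝ) * (basisConst e * (2 * Real.sqrt (Fintype.card n) * o)) * β) *
        Real.exp (-(δ * g.dist y y'))) := by
  have hc : ∀ x, ‖u x‖ ≤ Real.sqrt (Fintype.card n) := fun x => (uN_frobenius_norm_of_unitary (hu x)).le
  have hc' : ∀ x', ‖u' x'‖ ≤ Real.sqrt (Fintype.card n) := fun x' => (uN_frobenius_norm_of_unitary (hu' x')).le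
  have hoo : 0 ≤ basisConst e * (2 * Real.sqrt (Fintype.card n) * o) := mul_nonneg (basisConst_nonneg e) (by positivity)
  exact hasMaj_idef_gaugeConj_exp π (fun x => coordMat e (ContinuousLinearMap.mulLeftRight ℝ (Matrix n n ℂ) (u x) (u x)ᴴ)) (fun x' => coordMat e (ContinuousLinearMap.mulLeftRight ℝ (Matrix n n ℂ) (u' x') (u' x')ᴴ)) blk hβ hmD hoo (transpose_entry_le_one_of_orthogonal fun x => (uN_siteGauge_orthogonal e u he hu x).2)
    (entry_le_one_of_orthogonal fun x' => (uN_siteGauge_orthogonal e u' he hu' x').1) (uN_rowFit_siteGauge e π u u' hfit hc hc')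
    (uN_rowFit_siteGauge_transpose e π u u' he hu hu' hfit hc hc') hT hT' hDT

end TwoGauges

end Summit.QuantumFields.YangMills.BalabanUVNodes.N15.CurvedSpecies

end
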